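/-
Origin: expansion seat `planner-pub-hodgecm-pv02-g5-0`, handover #4 2026-08-18T08:56:03Z (`HOME/pub-hodgecm-pv02-g5/lean/Pv02g5/ArchAWeilSchrodingerWitness.lean`, md5 3f5c1d9a, 183 lines);
landed by the gen-7 packager in gate run 27 as `HodgeCM/PerL34/ArchAWeilSchrodingerWitness.lean` (import ^import Pv[0-9]+g[0-9]+\.→import HodgeCM.PerL34. ×2).
-/
/-
Copyright: HodgeCM PerL cell, unit pub-hodgecm-pv02-g5 (DAG-NODE PROVER #02 gen 5).  Additive leaf.
Lands as `HodgeCM/PerL34/ArchAWeilSchrodingerWitness.lean` (after `ArchAWeilFinite`, HANDOVER #2, and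
`ArchAWeilSchrodinger`, HANDOVER #3).
-/
import Summits.HodgeConjecture.HodgeCM.PerL34.ArchAWeilSchrodinger
import Summits.HodgeConjecture.HodgeCM.PerL34.ArchAWeilFinite

/-!
# N27 is NON-VACUOUS over the Schrödinger–lattice model: an explicit nonzero theta lift

`ArchAWeilSchrodinger.N27_schrodinger` proves PerL v5 Lemma 4.1(a) (LEMMAS N27,
`ArchA.LineArchData.N27_statement`) with NO hypothesis over pv14-g4's constructed Weil theta model
`SchwartzWeil.schrodingerModel E L m Γ hΓ`.  The statement has the shape
`∀ χ, ((∃ φ, lift χ φ ≠ 0) → HasArchJ χ → LocMatches χ) ∧ (LocMatches χ → HasArchJ χ)`, so a referee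
will ask whether its premises are ever inhabited (vacuity audit A1–A6).  This file answers in the kernel:

* `powChar m Γ hΓ : ContinuousMonoidHom (Circle ⧸ Γ) Circle` — the character `uΓ ↦ u^{-m}` of
  `[U(W)] = U(1) ⧸ Γ` (well defined because `Γ ⊆ μ_m`);
* `lift_powChar_θ` — the theta lift of the kernel `θ_Φ` against `powChar` is COMPUTED:
  `θ(θ_Φ, u^{-m}) = ∫_{[U(W)]} u^{-m} θ_Φ(·, u⁻¹) du = θ_Φ(·, 1)` (the integrand is constant because every
  kernel has weight `m`, `ArchAWeilSchrodinger.θ_omg_schrodinger`, and `[U(W)]` has Haar mass one);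
* `exists_lift_ne_zero` — `∃ χ φ, lift χ φ ≠ 0` (from pv14-g4's `schrodingerModel_θ_ne_zero`: some
  `θ_Φ(0, 1) ≠ 0`), i.e. the premise of the (⇒) clause of N27 is inhabited;
* `locMatches_powChar` — when the prescribed weights are `kJ b = m`, `powChar` has matching local
  components (`LocMatches`), hence (`N27_schrodinger`, (⇐) clause) an archimedean `J`-type lift
  (`hasArchJ_powChar`), and ALL premises of BOTH clauses of N27 are inhabited at `χ = powChar`
  (`N27_premises_inhabited`).

Second witness (§2): the hypotheses of file #2's net form `N27_ofWeilModel_finite` — `OrbitFinite` (the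
DEFINITIONAL `K`-finiteness read on kernels) and continuity of the real-place circles — HOLD in the model
(`orbitFinite_schrodinger`: every orbit span is the line `ℂ θ_Φ`), so file #2's route to N27 is inhabited too
(`N27_schrodinger_finite`, the same statement as `N27_schrodinger` obtained through `CircleWeights`).

PUBLISHED inputs cited as hypotheses: none.  No placeholders; axioms ⊆ {propext, Classical.choice, Quot.sound}.
-/

noncomputable section

open HodgeCM.PerL34 HodgeCM.PerL34.ArchA Module MeasureTheory

attribute [-instance] Quotient.instMeasurableSpace

namespace HodgeCM
namespace PerL34
namespace ArchAWeil

section Witness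

variable (E : Type) [NormedAddCommGroup E] [NormedSpace ℝ E] [FiniteDimensional ℝ E]
  (L : Submodule ℤ E) [DiscreteTopology L] (m : ℤ) (Γ : Subgroup Circle) (hΓ : ∀ u ∈ Γ, u ^ m = 1)

/-- The algebraic character `u ↦ u^{-m}` of `U(1)`. -/
def zpowNegHom : Circle →* Circle where
  toFun u := u ^ (-m)
  map_one' := one_zpow _
  map_mul' a b := mul_zpow a b _

/-- (Ported verbatim from the HodgeCMPerL package; no docstring in the source.) -/
@[simp] theorem zpowNegHom_apply (u : Circle) : zpowNegHom m u = u ^ (-m) := rfl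

include hΓ in
/-- (Ported verbatim from the HodgeCMPerL package; no docstring in the source.) -/
theorem le_ker_zpowNegHom : Γ ≤ (zpowNegHom m).ker := by
  intro γ hγ
  rw [MonoidHom.mem_ker, zpowNegHom_apply, zpow_neg, hΓ γ hγ, inv_one]

/-- **The character `uΓ ↦ u^{-m}` of `[U(W)] = U(1) ⧸ Γ`** (well defined as `Γ ⊆ μ_m`), as a continuous
character, i.e. an element of `(schrodingerLineData …).X`. -/
def powChar : ContinuousMonoidHom (Circle ⧸ Γ) Circle where
  toMonoidHom := QuotientGroup.lift Γ (zpowNegHom m) (le_ker_zpowNegHom m Γ hΓ)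
  continuous_toFun := by
    change Continuous (QuotientGroup.lift Γ (zpowNegHom m) (le_ker_zpowNegHom m Γ hΓ))
    rw [(QuotientGroup.isQuotientMap_mk Γ).continuous_iff]
    change Continuous fun u : Circle => QuotientGroup.lift Γ (zpowNegHom m) (le_ker_zpowNegHom m Γ hΓ) u
    simp only [QuotientGroup.lift_mk, zpowNegHom_apply]
    exact continuous_zpow (-m)

/-- (Ported verbatim from the HodgeCMPerL package; no docstring in the source.) -/
@[simp] theorem powChar_mk (u : Circle) :
    powChar m Γ hΓ (QuotientGroup.mk u : Circle ⧸ Γ) = u ^ (-m) := rfl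

variable [IsZLattice ℝ L] {RealPl : Type} (ι₁ : RealPl) (kJ : RealPl → ℤ)

/-- The kernel `θ_Φ` as an element of the N27 space `𝒮 = kerSpan`. -/
abbrev thetaVec (Φ : (SchwartzWeil.schrodingerModel E L m Γ hΓ).SK) :
    (schrodingerLineData E L m Γ hΓ ι₁ kJ).S :=
  ⟨(SchwartzWeil.schrodingerModel E L m Γ hΓ).θ Φ,
    θ_mem_kerSpan (SchwartzWeil.schrodingerModel E L m Γ hΓ) Φ⟩

omit [IsZLattice ℝ L] in
/-- Every kernel has weight `m`, pointwise: `θ_Φ(ξ, u⁻¹Γ) = u^m θ_Φ(ξ, 1)`. -/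
theorem θ_apply_inv (u : Circle) (Φ : (SchwartzWeil.schrodingerModel E L m Γ hΓ).SK)
    (ξ : Multiplicative E ⧸ SchwartzWeil.latticeSubgroup E L) :
    (SchwartzWeil.schrodingerModel E L m Γ hΓ).θ Φ (ξ, (QuotientGroup.mk u⁻¹ : Circle ⧸ Γ)) =
      ((u : ℂ) ^ m) * (SchwartzWeil.schrodingerModel E L m Γ hΓ).θ Φ (ξ, 1) := by
  have h := congrArg (fun F : C(_ × (Circle ⧸ Γ), ℂ) => F (ξ, 1))
    ((transl_θ (SchwartzWeil.schrodingerModel E L m Γ hΓ) u Φ).trans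
      (θ_omg_schrodinger E L m Γ hΓ u Φ))
  simp only [transl_apply, ContinuousMap.smul_apply, smul_eq_mul] at h
  rw [← h, ← QuotientGroup.mk_one, MulAction.Quotient.smul_mk, smul_eq_mul, mul_one]

/-- **The theta lift of a kernel against `u^{-m}` is computed:** `θ(θ_Φ, u^{-m}) = θ_Φ(·, 1)`. -/
theorem lift_powChar_θ (Φ : (SchwartzWeil.schrodingerModel E L m Γ hΓ).SK) :
    (schrodingerLineData E L m Γ hΓ ι₁ kJ).lift (powChar m Γ hΓ) (thetaVec E L m Γ hΓ ι₁ kJ Φ) =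
      slice ((SchwartzWeil.schrodingerModel E L m Γ hΓ).θ Φ) 1 := by
  rw [lineData_lift]
  have hconst : (fun q : Circle ⧸ Γ => ((powChar m Γ hΓ q : Circle) : ℂ) •
      slice ((SchwartzWeil.schrodingerModel E L m Γ hΓ).θ Φ) q⁻¹) =
      fun _ => slice ((SchwartzWeil.schrodingerModel E L m Γ hΓ).θ Φ) 1 := by
    funext q
    induction q using QuotientGroup.induction_on with
    | H u =>
      ext ξ
      rw [ContinuousMap.smul_apply, slice_apply, slice_apply, smul_eq_mul, powChar_mk,
        ← QuotientGroup.mk_inv, θ_apply_inv, ← mul_assoc, Circle.coe_zpow, zpow_neg,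
        inv_mul_cancel₀ (zpow_ne_zero m (Circle.coe_ne_zero u)), one_mul]
  rw [hconst, integral_const, probReal_univ, one_smul]

/-- **N27's (⇒) premise is inhabited:** some theta lift is nonzero. -/
theorem exists_lift_ne_zero :
    ∃ (χ : (schrodingerLineData E L m Γ hΓ ι₁ kJ).X) (φ : (schrodingerLineData E L m Γ hΓ ι₁ kJ).S),
      (schrodingerLineData E L m Γ hΓ ι₁ kJ).lift χ φ ≠ 0 := by
  obtain ⟨Φ, hΦ⟩ := SchwartzWeil.schrodingerModel_θ_ne_zero E L m Γ hΓ
  refine ⟨powChar m Γ hΓ, thetaVec E L m Γ hΓ ι₁ kJ Φ, fun h => hΦ ?_⟩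
  rw [lift_powChar_θ] at h
  have h1 := congrArg (fun F : C(_, ℂ) => F (QuotientGroup.mk (1 : Multiplicative E))) h
  simpa only [slice_apply, ContinuousMap.zero_apply, QuotientGroup.mk_one] using h1

/-- With prescribed weights `kJ b = m` at every real place, `u ↦ u^{-m}` has MATCHING local components. -/
theorem locMatches_powChar (hk : ∀ b, kJ b = m) :
    (schrodingerLineData E L m Γ hΓ ι₁ kJ).LocMatches (powChar m Γ hΓ) := by
  intro b u
  rw [lineData_loc, lineData_e, MonoidHom.id_apply, powChar_mk, hk b, Circle.coe_zpow]

/-- … hence (N27, (⇐) clause) an archimedean `J`-type theta lift. -/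
theorem hasArchJ_powChar (hk : ∀ b, kJ b = m) :
    (schrodingerLineData E L m Γ hΓ ι₁ kJ).HasArchJ (powChar m Γ hΓ) :=
  (N27_schrodinger E L m Γ hΓ ι₁ kJ (powChar m Γ hΓ)).2 (locMatches_powChar E L m Γ hΓ ι₁ kJ hk)

/-- **All premises of both clauses of N27 are inhabited at `χ = u^{-m}`** (weights `kJ ≡ m`): the
statement `N27_schrodinger` is not vacuously true. -/
theorem N27_premises_inhabited (hk : ∀ b, kJ b = m) :
    (∃ φ, (schrodingerLineData E L m Γ hΓ ι₁ kJ).lift (powChar m Γ hΓ) φ ≠ 0) ∧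
      (schrodingerLineData E L m Γ hΓ ι₁ kJ).HasArchJ (powChar m Γ hΓ) ∧
      (schrodingerLineData E L m Γ hΓ ι₁ kJ).LocMatches (powChar m Γ hΓ) := by
  obtain ⟨Φ, hΦ⟩ := SchwartzWeil.schrodingerModel_θ_ne_zero E L m Γ hΓ
  refine ⟨⟨thetaVec E L m Γ hΓ ι₁ kJ Φ, fun h => hΦ ?_⟩, hasArchJ_powChar E L m Γ hΓ ι₁ kJ hk,
    locMatches_powChar E L m Γ hΓ ι₁ kJ hk⟩
  rw [lift_powChar_θ] at h
  have h1 := congrArg (fun F : C(_, ℂ) => F (QuotientGroup.mk (1 : Multiplicative E))) h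
  simpa only [slice_apply, ContinuousMap.zero_apply, QuotientGroup.mk_one] using h1

/-! ## 2. File #2's hypotheses hold in the model: `OrbitFinite` and continuity -/

omit [IsZLattice ℝ L] in
/-- Every orbit span `span{θ_{ω(u)Φ} : u ∈ U(1)}` of the model is contained in the line `ℂ θ_Φ`. -/
theorem orbitSpan_schrodinger_le (b : RealPl) (Φ : (SchwartzWeil.schrodingerModel E L m Γ hΓ).SK) :
    orbitSpan (SchwartzWeil.schrodingerModel E L m Γ hΓ) (fun _ : RealPl => MonoidHom.id Circle) b Φ ≤
      ℂ ∙ (SchwartzWeil.schrodingerModel E L m Γ hΓ).θ Φ := by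
  refine Submodule.span_le.mpr ?_
  rintro _ ⟨u, rfl⟩
  dsimp only
  rw [MonoidHom.id_apply, θ_omg_schrodinger]
  exact Submodule.smul_mem _ _ (Submodule.mem_span_singleton_self _)

omit [IsZLattice ℝ L] in
/-- **`OrbitFinite` holds in the model** (file #2's DEFINITIONAL hypothesis is inhabited). -/
theorem orbitFinite_schrodinger :
    OrbitFinite (SchwartzWeil.schrodingerModel E L m Γ hΓ) (fun _ : RealPl => MonoidHom.id Circle) :=
  fun b Φ => Submodule.finiteDimensional_of_le (orbitSpan_schrodinger_le E L m Γ hΓ b Φ)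

/-- N27 over the model through file #2's net form (`OrbitFinite` + continuity ⇒ `WeightDecomposition` via
`CircleWeights.iSup_weightSpace_eq_top`): the hypotheses of `N27_ofWeilModel_finite` are all discharged. -/
theorem N27_schrodinger_finite : (schrodingerLineData E L m Γ hΓ ι₁ kJ).N27_statement :=
  have hι : ∀ _b : RealPl, Continuous (MonoidHom.id Circle) := fun _ => continuous_id
  N27_ofWeilModel_finite (SchwartzWeil.schrodingerModel E L m Γ hΓ) (fun _ : RealPl => MonoidHom.id Circle) ι₁
    kJ hι (orbitFinite_schrodinger E L m Γ hΓ)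

end Witness

end ArchAWeil
end PerL34
end HodgeCM

end
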